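import Literature.NumberTheory.Weil1964.AdelicDoublingGeometricFrame
import HarnessLib

/-!
# Second-degree forms of block matrices on `X□(𝔸) = 𝔸_F^{n+n}`; the main-orbit chirp IS `ψ_F(ξ·h) · (frame chirp)`

Topic `NumberTheory/Weil1964`; namespace `Literature.NumberTheory.Weil1964`.  KERNEL MATHEMATICS ONLY: theorems with proofs
about the tree's `sdForm`/`sdChar`/`chirp` (`AdelicSecondDegreeCharacter`) and `frameHalfRat` (`AdelicDoublingGeometricFrame`).

THE PRINTED MATHEMATICS.  In the unfolded Siegel Eisenstein series of the doubled unitary line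
(`Summits/…/Theorems/H413E2SWEisensteinUnfold`, after [Weil1965, n° 39 (30) p. 55] and [GelbartPiatetskishapiroRallis1987,
Part A §2]) the term of the coset of `γ = p + q√d ∈ E¹`, `γ ≠ 1`, is `∫ ψ_F(−½ ᵗv σ_γ v) (ω□(r_F δ)Ψ)(v) dν(v)` with the symmetric slope
`σ_γ = reindex [[β 𝕋, −½], [−½, −dβ 𝕋⁻¹]]`, `β = q / (2(1 − p))`.  Weil's Fourier analysis of the Eisenstein measure
([Weil1965, Chap. IV n° 41 (33)–(35), n° 46 p. 66]: `F*_Φ(ξ) = ∫ Φ(x) ψ(ξ · i_X(x)) dx`) wants this term written as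
`F*_Φ(ξ)` for ONE function `Φ` and a scalar `ξ ∈ F`: this file proves the algebra

  `ψ_F(−½ ᵗx σ_β x) = ψ_F((−β/2) · q_{C₀}(x)) · ψ_F(q_{C½}(x))`,   `q_{C₀}(x) = ᵗx₁ 𝕋 x₁ − d ᵗx₂ 𝕋⁻¹ x₂`,   `q_{C½}(x) = ½ ᵗx₁ x₂`,

i.e. `chirp (−½ σ_β) Φ = chirp ((−β/2) • C₀) (chirp C½ Φ)` (`chirp_neg_half_sigma_eq`), where `C½ = frameHalfRat` is the frame
matrix of `AdelicDoublingGeometricFrame` (so `chirp C½ (ω□(r_F δ)Ψ) = geomFrame Ψ = Ψ♮`) and `C₀` is the Gram matrix of the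
HERMITIAN NORM `x ↦ h(z_x, z_x)` written over `F` (`re h = ᵗa 𝕋 a − d ᵗb 𝕋 b` for `z = a + b√d`, `b = 𝕋⁻¹ x₂`).  The generic
block formula `sdForm_reindex_fromBlocks` (`q_{[[A,B],[C,D]]}(x₁,x₂) = q_A(x₁) + ᵗx₁Bx₂ + ᵗx₂Cx₁ + q_D(x₂)`) is §1.
-/

set_option autoImplicit false

noncomputable section

open scoped Matrix
open NumberField

namespace Literature.NumberTheory.Weil1964

variable (F : Type) [Field F] [NumberField F] {n : ℕ}

/-! ## §1 Second-degree forms of renumbered block matrices -/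

/-- **`q_{[[A,B],[C,D]]}(x₁, x₂) = q_A(x₁) + ᵗx₁ B x₂ + ᵗx₂ C x₁ + q_D(x₂)`** for the second-degree form
`sdForm S x = ᵗx S x` of a block matrix renumbered by `finSumFinEquiv`, on a vector written as `w ∘ finSumFinEquiv⁻¹`,
`w = (x₁, x₂)`. [cite: Weil1964, Chap. I n° 13 p. 160] -/
theorem sdForm_reindex_fromBlocks (A B C D : Matrix (Fin n) (Fin n) (AdeleRing (𝓞 F) F))
    (w : Fin n ⊕ Fin n → AdeleRing (𝓞 F) F) :
    sdForm F (Matrix.reindex finSumFinEquiv finSumFinEquiv (Matrix.fromBlocks A B C D))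
        (w ∘ ⇑(finSumFinEquiv (m := n) (n := n)).symm) =
      sdForm F A (w ∘ Sum.inl) + (w ∘ Sum.inl) ᵥ* B ⬝ᵥ (w ∘ Sum.inr) + (w ∘ Sum.inr) ᵥ* C ⬝ᵥ (w ∘ Sum.inl) +
        sdForm F D (w ∘ Sum.inr) := by
  rw [sdForm, sdForm, sdForm, Matrix.reindex_apply, Matrix.submatrix_vecMul_equiv, comp_equiv_dotProduct_comp_equiv]
  have h1 : (w ∘ ⇑(finSumFinEquiv (m := n) (n := n)).symm) ∘ ⇑(finSumFinEquiv (m := n) (n := n)).symm.symm = w := by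
    rw [Equiv.symm_symm, Function.comp_assoc, Equiv.symm_comp_self, Function.comp_id]
  rw [h1]
  conv_lhs => rw [← Sum.elim_comp_inl_inr w]
  rw [Matrix.vecMul_fromBlocks, sumElim_dotProduct_sumElim, Sum.elim_comp_inl, Sum.elim_comp_inr, add_dotProduct,
    add_dotProduct]
  ring

/-- the same on an arbitrary vector `x`, with `x₁ = x ∘ castAdd`, `x₂ = x ∘ natAdd`. [cite: Weil1964, Chap. I n° 13 p. 160] -/
theorem sdForm_reindex_fromBlocks' (A B C D : Matrix (Fin n) (Fin n) (AdeleRing (𝓞 F) F))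
    (x : Fin (n + n) → AdeleRing (𝓞 F) F) :
    sdForm F (Matrix.reindex finSumFinEquiv finSumFinEquiv (Matrix.fromBlocks A B C D)) x =
      sdForm F A (fun i => x (Fin.castAdd n i)) +
          (fun i => x (Fin.castAdd n i)) ᵥ* B ⬝ᵥ (fun i => x (Fin.natAdd n i)) +
          (fun i => x (Fin.natAdd n i)) ᵥ* C ⬝ᵥ (fun i => x (Fin.castAdd n i)) +
        sdForm F D (fun i => x (Fin.natAdd n i)) := by
  have hx : x = (x ∘ ⇑(finSumFinEquiv (m := n) (n := n))) ∘ ⇑(finSumFinEquiv (m := n) (n := n)).symm := by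
    rw [Function.comp_assoc, Equiv.self_comp_symm, Function.comp_id]
  conv_lhs => rw [hx]
  rw [sdForm_reindex_fromBlocks]
  simp only [Function.comp_def, finSumFinEquiv_apply_left, finSumFinEquiv_apply_right]

/-- `q` is homogeneous in the matrix: `q_{a S} = a · q_S` (second-degree forms are a module over the scalars). [cite: Weil1964, Chap. I n° 13 p. 160] -/
theorem sdForm_smul (a : AdeleRing (𝓞 F) F) (S : Matrix (Fin n) (Fin n) (AdeleRing (𝓞 F) F))
    (x : Fin n → AdeleRing (𝓞 F) F) : sdForm F (a • S) x = a * sdForm F S x := by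
  rw [sdForm, sdForm, Matrix.vecMul_smul, smul_dotProduct, smul_eq_mul]

/-! ## §2 The main-orbit chirp is `ψ_F((−β/2) q_{C₀}) · ψ_F(q_{C½})` -/

/-- **THE FORM IDENTITY** (adelic blocks `A`, `D`, scalars `b`, `dd`, `h`):
`−½ · q_{[[bA, −h], [−h, −dd·b·D]]}(x) = (−½ b) · q_{[[A, 0], [0, −dd·D]]}(x) + q_{[[0, h], [0, 0]]}(x)`.
[cite: Weil1965, Chap. IV n° 46 p. 66] -/
theorem sdForm_neg_half_block_eq (A D : Matrix (Fin n) (Fin n) (AdeleRing (𝓞 F) F)) (b dd h : AdeleRing (𝓞 F) F)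
    (x : Fin (n + n) → AdeleRing (𝓞 F) F) :
    sdForm F ((-⅟(2 : AdeleRing (𝓞 F) F)) • Matrix.reindex finSumFinEquiv finSumFinEquiv
        (Matrix.fromBlocks (b • A) (-(h • (1 : Matrix (Fin n) (Fin n) (AdeleRing (𝓞 F) F))))
          (-(h • (1 : Matrix (Fin n) (Fin n) (AdeleRing (𝓞 F) F)))) (-((dd * b) • D)))) x =
      sdForm F (((-⅟(2 : AdeleRing (𝓞 F) F)) * b) • Matrix.reindex finSumFinEquiv finSumFinEquiv
          (Matrix.fromBlocks A 0 0 (-(dd • D)))) x +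
        sdForm F (Matrix.reindex finSumFinEquiv finSumFinEquiv
          (Matrix.fromBlocks 0 (h • (1 : Matrix (Fin n) (Fin n) (AdeleRing (𝓞 F) F))) 0 0)) x := by
  rw [sdForm_smul, sdForm_smul, sdForm_reindex_fromBlocks', sdForm_reindex_fromBlocks', sdForm_reindex_fromBlocks']
  simp only [sdForm, Matrix.vecMul_smul, smul_dotProduct, smul_eq_mul, Matrix.vecMul_neg, neg_dotProduct,
    Matrix.vecMul_zero, zero_dotProduct, Matrix.vecMul_one, add_zero, zero_add]
  have hc : (fun i => x (Fin.natAdd n i)) ⬝ᵥ (fun i => x (Fin.castAdd n i)) =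
      (fun i => x (Fin.castAdd n i)) ⬝ᵥ (fun i => x (Fin.natAdd n i)) := dotProduct_comm _ _
  rw [hc]
  have h2 : (⅟(2 : AdeleRing (𝓞 F) F)) * 2 = 1 := invOf_mul_self' _
  linear_combination (h * ((fun i => x (Fin.castAdd n i)) ⬝ᵥ (fun i => x (Fin.natAdd n i)))) * h2

/-- entrywise `algebraMap` through a scalar multiple (private plumbing). [folklore] -/
private theorem map_smul' (a : F) (M : Matrix (Fin n) (Fin n) F) :
    (a • M).map (algebraMap F (AdeleRing (𝓞 F) F)) = (algebraMap F (AdeleRing (𝓞 F) F)) a • M.map (algebraMap F (AdeleRing (𝓞 F) F)) := by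
  ext i j
  simp only [Matrix.map_apply, Matrix.smul_apply, smul_eq_mul, map_mul]

/-- **THE MAIN-ORBIT CHIRP IS `ψ_F(ξ · q_{C₀}) · (FRAME CHIRP)`**: for the rational slope
`σ_β = reindex [[β T₀, −½], [−½, −dβ T₀⁻¹]]` of the `γ`-th big-cell term (`Theorems/H413E2SWEisensteinUnfold`),
`chirp (−½ σ_β ⊗ 1) Φ = chirp (ξ • C₀ ⊗ 1) (chirp (C½ ⊗ 1) Φ)` with `ξ = −β/2`, `C₀ = reindex (T₀ ⊕ −d T₀⁻¹)` (the Gram matrix of the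
hermitian norm over `F`) and `C½ = frameHalfRat` (so that `chirp (C½ ⊗ 1) (ω□(r_F δ)Ψ) = geomFrame Ψ = Ψ♮`): the `γ`-th term is
Weil's `F*_{Ψ♮}(ξ) = ∫ Ψ♮(x) ψ_F(ξ q_{C₀}(x)) dx`. [cite: Weil1965, Chap. IV n° 46 p. 66] [cite: Weil1965, n° 39 (30) p. 55] -/
theorem chirp_neg_half_ratMatrix_sigma0 (T₀ : Matrix (Fin n) (Fin n) F) (β d : F)
    (Φ : (Fin (n + n) → (AdeleRing (𝓞 F) F)) → ℂ) :
    chirp F ((-⅟(2 : (AdeleRing (𝓞 F) F))) • ratMatrix F (Matrix.reindex finSumFinEquiv finSumFinEquiv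
        (Matrix.fromBlocks (β • T₀) (-((1 / 2 : F) • (1 : Matrix (Fin n) (Fin n) F))) (-((1 / 2 : F) • (1 : Matrix (Fin n) (Fin n) F)))
          (-((d * β) • T₀⁻¹))))) Φ =
      chirp F ((algebraMap F (AdeleRing (𝓞 F) F)) (-(β / 2)) • ratMatrix F (Matrix.reindex finSumFinEquiv finSumFinEquiv
          (Matrix.fromBlocks T₀ 0 0 (-(d • T₀⁻¹)))))
        (chirp F (ratMatrix F (frameHalfRat F)) Φ) := by
  -- the three matrices, renumbered blocks read in `𝔸_F`
  have hS₁ : ratMatrix F (Matrix.reindex finSumFinEquiv finSumFinEquiv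
        (Matrix.fromBlocks (β • T₀) (-((1 / 2 : F) • (1 : Matrix (Fin n) (Fin n) F))) (-((1 / 2 : F) • (1 : Matrix (Fin n) (Fin n) F)))
          (-((d * β) • T₀⁻¹)))) =
      Matrix.reindex finSumFinEquiv finSumFinEquiv
        (Matrix.fromBlocks ((algebraMap F (AdeleRing (𝓞 F) F)) β • T₀.map (algebraMap F (AdeleRing (𝓞 F) F))) (-((algebraMap F (AdeleRing (𝓞 F) F)) (1 / 2) • (1 : Matrix (Fin n) (Fin n) (AdeleRing (𝓞 F) F))))
          (-((algebraMap F (AdeleRing (𝓞 F) F)) (1 / 2) • (1 : Matrix (Fin n) (Fin n) (AdeleRing (𝓞 F) F)))) (-(((algebraMap F (AdeleRing (𝓞 F) F)) d * (algebraMap F (AdeleRing (𝓞 F) F)) β) • T₀⁻¹.map (algebraMap F (AdeleRing (𝓞 F) F))))) := by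
    rw [ratMatrix, Matrix.reindex_apply, Matrix.reindex_apply, ← Matrix.submatrix_map, Matrix.fromBlocks_map,
      Matrix.map_neg _ (map_neg _), Matrix.map_neg _ (map_neg _), map_smul', map_smul', map_smul', map_mul,
      Matrix.map_one _ (map_zero _) (map_one _)]
  have hS₂ : ratMatrix F (Matrix.reindex finSumFinEquiv finSumFinEquiv (Matrix.fromBlocks T₀ 0 0 (-(d • T₀⁻¹)))) =
      Matrix.reindex finSumFinEquiv finSumFinEquiv
        (Matrix.fromBlocks (T₀.map (algebraMap F (AdeleRing (𝓞 F) F))) 0 0 (-((algebraMap F (AdeleRing (𝓞 F) F)) d • T₀⁻¹.map (algebraMap F (AdeleRing (𝓞 F) F))))) := by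
    rw [ratMatrix, Matrix.reindex_apply, Matrix.reindex_apply, ← Matrix.submatrix_map, Matrix.fromBlocks_map,
      Matrix.map_neg _ (map_neg _), map_smul', Matrix.map_zero _ (map_zero _)]
  have hS₃ : ratMatrix F (frameHalfRat F) =
      Matrix.reindex finSumFinEquiv finSumFinEquiv
        (Matrix.fromBlocks 0 ((algebraMap F (AdeleRing (𝓞 F) F)) (1 / 2) • (1 : Matrix (Fin n) (Fin n) (AdeleRing (𝓞 F) F))) 0 0) := by
    rw [ratMatrix, frameHalfRat, Matrix.reindex_apply, Matrix.reindex_apply, ← Matrix.submatrix_map, Matrix.fromBlocks_map,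
      Matrix.map_zero _ (map_zero _), Matrix.diagonal_map (map_zero _), one_div, Matrix.smul_one_eq_diagonal]
  have hc : (algebraMap F (AdeleRing (𝓞 F) F)) (-(β / 2)) = (-⅟(2 : (AdeleRing (𝓞 F) F))) * (algebraMap F (AdeleRing (𝓞 F) F)) β := by
    rw [invOf_two_eq_algebraMap, ← map_neg, ← map_mul]
    congr 1
    ring
  funext x
  rw [chirp_apply, chirp_apply, chirp_apply, ← mul_assoc, hS₁, hS₂, hS₃, hc, sdChar, sdChar, sdChar, ← Circle.coe_mul,
    ← AddChar.map_add_eq_mul, sdForm_neg_half_block_eq]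

end Literature.NumberTheory.Weil1964

end
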